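import Summits.ValiantsHypothesis.ValiantsHypothesis.Theorems.LacunarySymmetroidMatrixDescartesDoorA26WallBubblingBubblingClusters

/-!
# Wall bubbling for `DoorA26` — (W) chain piece: THE CHAIN CEILING WITH CONFLUENT SLOTS (the count that fixes the statement of the (W-split) gap)

HONEST FRAMING.  Bookkeeping lemma for obligation (W) `stub_weylFaces` of `Cruxes/DoorA26/Lines/wall_bubbling.lean` (stmt-ValiantsHypothesis-19979
`DoorA26`; OPEN, typed, never asserted), W2 seat val-sym-door-p1 g14; work order (r1) of the line lead val-idea-15 g3 / desk R2761 (bus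
2026-08-28T19:28–19:29Z) after this seat's PAPER FLAG (19:18Z): «the chain count CAPS AT 20, NOT 19».

THE COUNT (abstract, finite; no analysis).  A chain of `C` zero clusters at a point of the exponent simplex is summarised by: the finite VALUE SET `V`
(pair-sum values), SLOT MULTIPLICITIES `n w ≥ 1` (number of distinct member exponents merging into the value `w`; at a generic Weyl face: `3` for the
triple, `2` for the four doubletons, `1` for the ten singletons — `Σ_w (n w − 1) = 6`, `|V| = 15`), per cluster `c` its ACTIVE set `Λ c ⊆ V`
(non-empty), the DEGREES `d c w` of the limit slot polynomials, and its zero count `m c`.  Inputs, each the output of an analytic chain piece: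
(B3/W4 #5/W1 #12, extended count with multiplicity + W2 #5 transfer) `m c + 1 ≤ Σ_{w ∈ Λ c} (d c w + 1)`; (B8, tropical monotonicity) the `Λ c` are
ordered, consecutive clusters sharing at most an endpoint; (SLOT SPLITTING, paper: a class's `n w − 1` confluent degrees are shared out among the
clusters, `Σ_c d c w ≤ n w − 1` — the transfer `τ ↦ τ + Λ′T`, `Λ′ → ∞`, kills a doubleton's degree downstream; the triple can split `(1,1)`).
OUTPUT: `Σ_c m c ≤ Σ_{w∈V} (n w − 1) + (|V| − 1)` — at a generic Weyl face `6 + 14 = 20` FOR EVERY NUMBER OF CLUSTERS (`chain_ceiling`,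
`chain_ceiling_twenty`).  The door `ConfluentDoor26` lowers the ceiling to `19` only for a cluster with all `21` slots live (one cluster); chains with
`≥ 2` clusters reaching `20` («broken confluent chains», e.g. `(19,1)` at the top Weyl face with the `t²e^{2t}` slot dead) are the OPEN, NAMED residual
«(W-split) multi-scale linking» (register R2761).  This file is the arithmetic only; it asserts nothing about pencils.

No new definitions; nothing here bears on `DoorA26`, `MatrixDescartes` (stmt-ValiantsHypothesis-18050) or `VP ≠ VNP`.

[folklore] double counting; [this work] the bookkeeping.
-/

-- `Summit.ValiantsHypothesis.ValiantsHypothesis.…` repeats a component by the D-0017 layout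
-- (single-conjunct summit), which the `dupNamespace` linter flags; the name is mandated.
set_option linter.dupNamespace false

namespace Summit.ValiantsHypothesis.ValiantsHypothesis.Theorems.LacunarySymmetroidMatrixDescartes.WallBubbling

open Finset
open scoped BigOperators

/-- **THE CHAIN CEILING WITH CONFLUENT SLOTS.**  Tropically ordered non-empty active sets `Λ c ⊆ V`, per-cluster extended counts
`m c + 1 ≤ Σ_{w∈Λ c}(d c w + 1)`, and the slot-splitting rule `Σ_c [w ∈ Λ c]·d c w ≤ n w − 1` give `Σ_c m c ≤ Σ_{w∈V}(n w − 1) + (|V| − 1)`.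
[this work] -/
theorem chain_ceiling (V : Finset ℝ) (n : ℝ → ℕ) {C : ℕ} (Λ : Fin C → Finset ℝ) (d : Fin C → ℝ → ℕ) (m : Fin C → ℕ)
    (hne : ∀ c, (Λ c).Nonempty) (hsub : ∀ c, Λ c ⊆ V)
    (hmono : ∀ c c', c < c' → ∀ w ∈ Λ c, ∀ w' ∈ Λ c', w ≤ w')
    (hsplit : ∀ w ∈ V, (∑ c, if w ∈ Λ c then d c w else 0) ≤ n w - 1)
    (hcount : ∀ c, m c + 1 ≤ ∑ w ∈ Λ c, (d c w + 1)) :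
    ∑ c, m c ≤ ∑ w ∈ V, (n w - 1) + (V.card - 1) := by
  classical
  -- per cluster: `m c ≤ Σ_{Λ c} d + (|Λ c| − 1)`
  have h1 : ∀ c, m c ≤ (∑ w ∈ Λ c, d c w) + ((Λ c).card - 1) := by
    intro c
    have hc := hcount c
    rw [Finset.sum_add_distrib, Finset.sum_const, smul_eq_mul, mul_one] at hc
    have hcard : 1 ≤ (Λ c).card := Finset.card_pos.mpr (hne c)
    omega
  -- the degrees, double counted through `V`
  have h2 : ∑ c, ∑ w ∈ Λ c, d c w = ∑ w ∈ V, ∑ c, (if w ∈ Λ c then d c w else 0) := by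
    rw [Finset.sum_comm]
    refine Finset.sum_congr rfl fun c _ => ?_
    rw [← Finset.sum_filter]
    congr 1
    ext w
    simp only [Finset.mem_filter]
    exact ⟨fun h => ⟨hsub c h, h⟩, fun h => h.2⟩
  have h3 : ∑ c, ∑ w ∈ Λ c, d c w ≤ ∑ w ∈ V, (n w - 1) := by
    rw [h2]; exact Finset.sum_le_sum hsplit
  -- the interval count (B9)
  have h4 : ∑ c, ((Λ c).card - 1) ≤ V.card - 1 := Bubbling.interval_count V Λ hne hsub hmono
  calc ∑ c, m c ≤ ∑ c, ((∑ w ∈ Λ c, d c w) + ((Λ c).card - 1)) := Finset.sum_le_sum fun c _ => h1 c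
    _ = ∑ c, ∑ w ∈ Λ c, d c w + ∑ c, ((Λ c).card - 1) := Finset.sum_add_distrib
    _ ≤ ∑ w ∈ V, (n w - 1) + (V.card - 1) := Nat.add_le_add h3 h4

/-- **THE CEILING IS 20 AT A GENERIC WEYL FACE, FOR EVERY NUMBER OF CLUSTERS**: `|V| = 15` values and `Σ_w (n w − 1) = 6` confluent degrees
(`21` slots) give `Σ_c m c ≤ 20` — the SAME ceiling as one cluster; the door lowers it to `19` only for a single cluster with all slots live.
[this work] -/
theorem chain_ceiling_twenty (V : Finset ℝ) (n : ℝ → ℕ) {C : ℕ} (Λ : Fin C → Finset ℝ) (d : Fin C → ℝ → ℕ) (m : Fin C → ℕ)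
    (hne : ∀ c, (Λ c).Nonempty) (hsub : ∀ c, Λ c ⊆ V)
    (hmono : ∀ c c', c < c' → ∀ w ∈ Λ c, ∀ w' ∈ Λ c', w ≤ w')
    (hsplit : ∀ w ∈ V, (∑ c, if w ∈ Λ c then d c w else 0) ≤ n w - 1)
    (hcount : ∀ c, m c + 1 ≤ ∑ w ∈ Λ c, (d c w + 1))
    (hV : V.card = 15) (hslots : ∑ w ∈ V, (n w - 1) = 6) :
    ∑ c, m c ≤ 20 := by
  have h := chain_ceiling V n Λ d m hne hsub hmono hsplit hcount
  rw [hV, hslots] at h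
  exact h

/-- **… and the ceiling is ATTAINED by the abstract bookkeeping with TWO clusters** (the arithmetic of the tight split `(19,1)`: fifteen values
`0, …, 14`, the top value carrying `3` slots split as degrees `1 + 1`, four values carrying `2` slots, cluster `1` active everywhere with `19` zeros,
cluster `2` active at the top value only with `1` zero): so NO counting argument on these inputs closes (W) at a generic face — the residual
«(W-split)» is a statement about pencils, not about the count. [this work] -/
theorem chain_ceiling_attained_two_clusters :
    ∃ (V : Finset ℝ) (n : ℝ → ℕ) (Λ : Fin 2 → Finset ℝ) (d : Fin 2 → ℝ → ℕ) (m : Fin 2 → ℕ),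
      (∀ c, (Λ c).Nonempty) ∧ (∀ c, Λ c ⊆ V) ∧
      (∀ c c', c < c' → ∀ w ∈ Λ c, ∀ w' ∈ Λ c', w ≤ w') ∧
      (∀ w ∈ V, (∑ c, if w ∈ Λ c then d c w else 0) ≤ n w - 1) ∧
      (∀ c, m c + 1 ≤ ∑ w ∈ Λ c, (d c w + 1)) ∧
      V.card = 15 ∧ ∑ w ∈ V, (n w - 1) = 6 ∧ ∑ c, m c = 20 := by
  classical
  -- values `0..14`; the top value `14` is the triple (3 slots), `10..13` the doubletons (2 slots); cluster `0` is active everywhere with the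
  -- degrees `1` at `10..14` (19 zeros), cluster `1` only at the top value with degree `1` (one zero)
  set V : Finset ℝ := (Finset.range 15).image (fun i : ℕ => (i : ℝ)) with hV
  set n : ℝ → ℕ := fun w => if w = 14 then 3 else if w = 10 ∨ w = 11 ∨ w = 12 ∨ w = 13 then 2 else 1 with hn
  set d₀ : ℝ → ℕ := fun w => if w = 14 then 1 else if w = 10 ∨ w = 11 ∨ w = 12 ∨ w = 13 then 1 else 0 with hd₀
  have hinj : ∀ x ∈ Finset.range 15, ∀ y ∈ Finset.range 15, ((x : ℕ) : ℝ) = (y : ℝ) → x = y :=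
    fun x _ y _ h => by exact_mod_cast h
  have hmemV : ∀ i, i < 15 → ((i : ℕ) : ℝ) ∈ V := fun i hi =>
    Finset.mem_image.mpr ⟨i, Finset.mem_range.mpr hi, rfl⟩
  refine ⟨V, n, ![V, {(14 : ℝ)}], ![d₀, fun _ => 1], ![19, 1], ?_, ?_, ?_, ?_, ?_, ?_, ?_, ?_⟩
  · refine Fin.forall_fin_two.mpr ⟨⟨0, ?_⟩, ⟨14, ?_⟩⟩
    · simpa using hmemV 0 (by norm_num)
    · simp
  · refine Fin.forall_fin_two.mpr ⟨?_, ?_⟩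
    · simp
    · intro w hw
      simp only [Matrix.cons_val_one, Matrix.cons_val_fin_one, Finset.mem_singleton] at hw
      rw [hw]
      exact_mod_cast hmemV 14 (by norm_num)
  · intro c c' hcc' w hw w' hw'
    have key : ∀ a b : Fin 2, a < b → a = 0 ∧ b = 1 := by decide
    obtain ⟨rfl, rfl⟩ := key c c' hcc'
    simp only [Matrix.cons_val_one, Matrix.cons_val_fin_one, Finset.mem_singleton] at hw'
    simp only [Matrix.cons_val_zero, hV, Finset.mem_image, Finset.mem_range] at hw
    obtain ⟨i, hi, rfl⟩ := hw
    rw [hw']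
    exact_mod_cast (by omega : i ≤ 14)
  · intro w hw
    rw [hV, Finset.mem_image] at hw
    obtain ⟨i, hi, rfl⟩ := hw
    rw [Finset.mem_range] at hi
    rw [Fin.sum_univ_two]
    simp only [Matrix.cons_val_zero, Matrix.cons_val_one, Matrix.cons_val_fin_one, Finset.mem_singleton]
    rw [if_pos (hmemV i hi), hn, hd₀]
    simp only
    interval_cases i <;> norm_num
  · refine Fin.forall_fin_two.mpr ⟨?_, ?_⟩
    · simp only [Matrix.cons_val_zero]
      rw [hV, Finset.sum_image hinj, hd₀]
      simp only [Finset.sum_range_succ, Finset.sum_range_zero]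
      norm_num
    · simp
  · rw [hV, Finset.card_image_of_injOn hinj, Finset.card_range]
  · rw [hV, Finset.sum_image hinj, hn]
    simp only [Finset.sum_range_succ, Finset.sum_range_zero]
    norm_num
  · rw [Fin.sum_univ_two]
    simp

end Summit.ValiantsHypothesis.ValiantsHypothesis.Theorems.LacunarySymmetroidMatrixDescartes.WallBubbling
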